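import Mathlib.Data.Rat.Defs
import Mathlib.Algebra.Order.Field.Basic
import Mathlib.Tactic.Linarith
import Mathlib.Tactic.NormNum
import Mathlib.Tactic.IntervalCases
import Mathlib.Tactic.Ring
import Mathlib.Tactic.LinearCombination
import HarnessLib

/-!
# THEOREM AB+ — the AM form of the one-child boundary-star cycle has nonnegative (s², d², sd)-coefficients for EVERY length:
# an all-`k` certificate by one polyhedral invariant of a 12-state rational automaton
# (Sahi programme, prover prim-sahi-p2 gen 64)

Support file (`--supports stmt-CriticalPhenomena-4575`).  Standard axioms, no sorries, no named facts.  Memo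
`run/shared/lean/prim/prim-sahi/FROM-prim-sahi-p2-gen64-ABPLUS-PROOF.md`, `prim-sahi-p2/PROOF-E3.md` §74.

THE OBJECT.  For the cycle `a–y₁–…–y_k–a` through the apex with one boundary child `(u_t, w_t)` at every `y_t`
(gens 60–63 of the programme), the AM form `A = #P1 + #P2 − 2·#bad` is a multilinear function of the site letters
`p = s² , q = d², r = s d` (`s = u+w`, `d = u−w`); its coefficients `A[w]`, `w ∈ {p,q,r}^k`, form a rational series with a
12-dimensional linear representation (gen 63, `lab/amin.py`).  Gen 64 found its NORMAL FORM over `ℚ`: the direct sum of the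
8-state automaton `stepA` (states `t, l0, e1a, e2a, e1b, e2b, o1, o2`) and the 4-state automaton `stepB`
(states `E5, E4, f1, f2`) below, with the initial/final vectors `omegaA/alphaA`, `omegaB/alphaB`; the equality of the two
12-dimensional representations is an exact finite computation (`gen64/lab64/nf_equiv.py`: the difference representation has
Schützenberger-minimal dimension `0`), re-checkable by the referee against independent engines; it is NOT re-proved here.
What IS proved here, for the explicit automaton:

* `coeff_nonneg` — **for every word `w` (every length `k`), `0 ≤ coeff w`**, where `coeff w = coeffA w + coeffB w`,
  `coeffA w = alphaA · (stepA w₁ (stepA w₂ (… omegaA)))` (column action) and likewise `coeffB`.  This is CONJECTURE AB+ of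
  gen 63 (verified there for `k ≤ 12`, 797 160 words) for all `k`; equivalently the two-copy statistic `N₁ + N₂ − 2N̄_bad` is
  a positive-definite function on `Z₂^{2k}` for every `k`; consequently (memo §0) `2·#bad ≤ #P1 + #P2` for every cycle
  through the apex, of any length, whose vertices carry one pendant (P)-piece each, all leaning the same way.
* The proof is ONE inductive polyhedral invariant (`inv_evalA`: eleven linear inequalities in the eight coordinates and two
  "ghost" coordinates `lam, mu` that remember how much of the last two `q`/`p`-jumps is still outside the cone
  `K₁ = cone{e₁, (−1,1)}`), found from the module structure of the representation (memo §5–§6: the W-module with its left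
  `3/4`-eigenvector `γ = (−45/14, −30, −45/2)`, the cone `K_{14/5}` of LEMMA Q, the cone `{o₂ ≤ 0, 4o₁ ≤ 5o₂}` of `R²|O_b`) and
  checked to be inductive by exact Farkas certificates (`gen64/lab64/farkas_check.py`); here `linarith` re-finds them.
* `coeffB` has the product structure of memo §3 (`invB`: `E5 ≤ 0`, `−f ∈ K₁`), and `coeff (p^k) = 2D_k/4^k` is handled by
  `coeffB_replicate_p` (`= 3(5/4)^k − 12 ≥ 0` for `k ≥ 7`) and a finite evaluation for `k ≤ 6`.
[this work] (gen 64).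
-/

namespace Summit.CriticalPhenomena.PercolationContinuityZ3.Theorems.ProductFormABPlus

/-- The three site letters `p = s²`, `q = d²`, `r = sd` of the AM-form series. [this work] -/
inductive Letter : Type
  | p | q | r
  deriving DecidableEq, Repr

/-- State of the 8-state `a`-part automaton (coordinates `t, ℓ₀, e₁′, e₂′, e₁″, e₂″, o₁, o₂` of the normal form, memo §2). [this work] -/
structure StA where
  /-- coordinate of the top state `t` -/
  t : ℚ
  /-- coordinate of the bottom character state `ℓ₀` -/
  l0 : ℚ
  /-- first coordinate of the U-block `U¹` -/
  e1a : ℚ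
  /-- second coordinate of the U-block `U¹` -/
  e2a : ℚ
  /-- first coordinate of the U-block `U²` -/
  e1b : ℚ
  /-- second coordinate of the U-block `U²` -/
  e2b : ℚ
  /-- first coordinate of the odd sector `O_b` -/
  o1 : ℚ
  /-- second coordinate of the odd sector `O_b` -/
  o2 : ℚ

/-- State of the 4-state `b`-part automaton (coordinates `E5, E4, f₁, f₂`, memo §2). [this work] -/
structure StB where
  /-- the `(5/4, 1/4)`-character state -/
  E5 : ℚ
  /-- the `(1, 0)`-character state (only sees `p`) -/
  E4 : ℚ
  /-- first coordinate of the U-block `U³ = O_a` -/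
  f1 : ℚ
  /-- second coordinate of the U-block `U³ = O_a` -/
  f2 : ℚ

/-- One step of the `a`-part automaton (column action of the normal-form matrices `P, Q, R`, memo §2). [this work] -/
def stepA : Letter → StA → StA
  | .p, s => ⟨(3/4) * s.t, (3/4) * s.l0 + (7/3) * s.e2a,
      -(15/3200) * s.t - (5/2) * s.e2a, -(60/3200) * s.t + s.e1a + (15/4) * s.e2a,
      -(12/3200) * s.t - (5/2) * s.e2b, -(48/3200) * s.t + s.e1b + (15/4) * s.e2b,
      (5/4) * s.o1, (5/4) * s.o2⟩
  | .q, s => ⟨(1/4) * s.t, (7/30) * s.t + (1/4) * s.l0 - (28/9) * s.e1a - (98/9) * s.e2a,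
      -(9/128) * s.t + (3/4) * s.e1a + (37/16) * s.e2a, (3/160) * s.t,
      (59/800) * s.t + (3/4) * s.e1b + (37/16) * s.e2b, -(1/40) * s.t,
      (1/4) * s.o1, (1/4) * s.o2⟩
  | .r, s => ⟨0, 0, s.o1, 0, s.o2, 0,
      -(3/80) * s.t + (3/4) * s.e1a + (37/16) * s.e2a, (3/4) * s.e1b + (37/16) * s.e2b⟩

/-- One step of the `b`-part automaton (memo §2). [this work] -/
def stepB : Letter → StB → StB
  | .p, s => ⟨(5/4) * s.E5, s.E4, -(5/2) * s.f2, s.f1 + (15/4) * s.f2⟩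
  | .q, s => ⟨(1/4) * s.E5, 0, (3/4) * s.f1 + (37/16) * s.f2, 0⟩
  | .r, s => ⟨(3/4) * s.f1 + (37/16) * s.f2, 0, s.E5, 0⟩

/-- Initial vector of the `a`-part: `ω_a = (8/3)·t`. [this work] -/
def omegaA : StA := ⟨8/3, 0, 0, 0, 0, 0, 0, 0⟩

/-- Initial vector of the `b`-part: `ω_b = −(1/10)·E5 + E4`. [this work] -/
def omegaB : StB := ⟨-(1/10), 1, 0, 0⟩

/-- Final functional of the `a`-part: `α_a = (27/8; −45/14; −75/2, −525/8; 75/8, 1725/32; 0, 0)`. [this work] -/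
def alphaA (s : StA) : ℚ :=
  (27/8) * s.t - (45/14) * s.l0 - (75/2) * s.e1a - (525/8) * s.e2a + (75/8) * s.e1b + (1725/32) * s.e2b

/-- Final functional of the `b`-part: `α_b = (−30, −12, 0, 0)`. [this work] -/
def alphaB (s : StB) : ℚ := -30 * s.E5 - 12 * s.E4

/-- The `a`-part state reached by a word (column action: the leftmost letter acts last). [this work] -/
def evalA : List Letter → StA
  | [] => omegaA
  | x :: w => stepA x (evalA w)

/-- The `b`-part state reached by a word. [this work] -/
def evalB : List Letter → StB
  | [] => omegaB
  | x :: w => stepB x (evalB w)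

/-- `A_a[w]`, the `a`-part of the coefficient series. [this work] -/
def coeffA (w : List Letter) : ℚ := alphaA (evalA w)

/-- `A_b[w]`, the `b`-part of the coefficient series. [this work] -/
def coeffB (w : List Letter) : ℚ := alphaB (evalB w)

/-- `A[w] = A_a[w] + A_b[w]`: the `(s²,d²,sd)`-coefficient of the AM form `#P1 + #P2 − 2#bad` indexed by the word `w`
(times `4^k` these are the integer tables of gen 63, e.g. `4·A[q] = 12`, `16·A[pq] = 72`, `16·A[rr] = 96`). [this work] -/
def coeff (w : List Letter) : ℚ := coeffA w + coeffB w

/-! ### 1. Bookkeeping: parity of `r`, the all-`p` words, the two ghost coordinates -/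

/-- `true` iff the word contains an even number of letters `r` (then the state lies in the even sector `E_a`). [this work] -/
def evenR : List Letter → Bool
  | [] => true
  | .r :: w => !(evenR w)
  | _ :: w => evenR w

/-- `true` iff every letter of the word is `p`. [this work] -/
def allP : List Letter → Bool
  | [] => true
  | .p :: w => allP w
  | _ :: _ => false

/-- The ghost coordinates `(λ, μ)`: `λ` = weight of the most recent `q`-jump from `t` (still at distance `< 2` from the cone `K₁`),
`μ` = the same one letter `p` later; both reset by `r`. [this work] -/
def ghost : List Letter → ℚ × ℚ
  | [] => (0, 0)
  | .p :: w => (0, (ghost w).1)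
  | .q :: w => ((evalA w).t, 0)
  | .r :: _ => (0, 0)

/-! ### 2. The invariant -/

/-- THE INVARIANT along every word.  Even sector (even number of `r`): eleven linear inequalities in the state `s = evalA w`
and the ghosts `(λ, μ) = ghost w` — `t ≥ 0`; the `U¹`-part minus `λ·u_q` lies in `−K₁` (`K₁ = cone{e₁,(−1,1)}`); the
`U²`-component modulo `W_{4/5}` minus `λw′ + μPw′` lies in `K₁`; the `γ`-value dominates `(15/16)λ + (9/64)μ`; LEMMA Q
(`φ(u²) ≤ 0`, `u² − (3/200)t·e₁ ∈ −K_{14/5}`); `λ, μ ≥ 0` — and the odd coordinates vanish.  Odd sector: `(o₁,o₂)` lies in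
the cone `{o₂ ≤ 0, 4o₁ ≤ 5o₂}` (the two eigenvectors of `R²|O_b`) and the even coordinates vanish.  Each of the 4 × (13 + 8)
preservation facts is a nonnegative combination of the hypotheses (exact Farkas certificates, `gen64/lab64/farkas_check.py`);
`linarith` re-derives them. [this work] -/
theorem inv_evalA (w : List Letter) :
    (evenR w = true →
      (0 ≤ (evalA w).t ∧
      0 ≤ -(evalA w).e2a + (3/160) * (ghost w).1 ∧
      0 ≤ -(evalA w).e1a - (evalA w).e2a - (33/640) * (ghost w).1 ∧
      0 ≤ (evalA w).e2b - (4/5) * (evalA w).e2a + (1/25) * (ghost w).1 + (1/50) * (ghost w).2 ∧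
      0 ≤ (evalA w).e1b + (evalA w).e2b - (4/5) * ((evalA w).e1a + (evalA w).e2a) - (9/100) * (ghost w).1 - (2/25) * (ghost w).2 ∧
      0 ≤ -(45/14) * (evalA w).l0 - 30 * (evalA w).e1a - (45/2) * (evalA w).e2a - (15/16) * (ghost w).1 - (9/64) * (ghost w).2 ∧
      0 ≤ -(3/4) * (evalA w).e1b - (37/16) * (evalA w).e2b ∧
      0 ≤ -(evalA w).e2b ∧
      0 ≤ -(evalA w).e1b + (3/200) * (evalA w).t - (14/5) * (evalA w).e2b ∧
      0 ≤ (ghost w).1 ∧ 0 ≤ (ghost w).2 ∧ (evalA w).o1 = 0 ∧ (evalA w).o2 = 0)) ∧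
    (evenR w = false →
      (0 ≤ -(evalA w).o2 ∧ 0 ≤ -4 * (evalA w).o1 + 5 * (evalA w).o2 ∧
      (evalA w).t = 0 ∧ (evalA w).l0 = 0 ∧ (evalA w).e1a = 0 ∧ (evalA w).e2a = 0 ∧ (evalA w).e1b = 0 ∧ (evalA w).e2b = 0)) := by
  induction w with
  | nil =>
    refine ⟨fun _ => ?_, fun h => ?_⟩
    · simp only [evalA, omegaA, ghost]; norm_num
    · simp [evenR] at h
  | cons x w ih =>
    obtain ⟨ihE, ihO⟩ := ih
    cases x with
    | p =>
      refine ⟨fun h => ?_, fun h => ?_⟩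
      · have hw : evenR w = true := by simpa [evenR] using h
        obtain ⟨h1, h2, h3, h4, h5, h6, h7, h8, h9, h10, h11, h12, h13⟩ := ihE hw
        refine ⟨?_, ?_, ?_, ?_, ?_, ?_, ?_, ?_, ?_, ?_, ?_, ?_, ?_⟩ <;> (try simp only [evalA, ghost, stepA]) <;> first | trivial | linarith
      · have hw : evenR w = false := by simpa [evenR] using h
        obtain ⟨h1, h2, h3, h4, h5, h6, h7, h8⟩ := ihO hw
        refine ⟨?_, ?_, ?_, ?_, ?_, ?_, ?_, ?_⟩ <;> (try simp only [evalA, stepA]) <;> first | trivial | linarith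
    | q =>
      refine ⟨fun h => ?_, fun h => ?_⟩
      · have hw : evenR w = true := by simpa [evenR] using h
        obtain ⟨h1, h2, h3, h4, h5, h6, h7, h8, h9, h10, h11, h12, h13⟩ := ihE hw
        refine ⟨?_, ?_, ?_, ?_, ?_, ?_, ?_, ?_, ?_, ?_, ?_, ?_, ?_⟩ <;> (try simp only [evalA, ghost, stepA]) <;> first | trivial | linarith
      · have hw : evenR w = false := by simpa [evenR] using h
        obtain ⟨h1, h2, h3, h4, h5, h6, h7, h8⟩ := ihO hw
        refine ⟨?_, ?_, ?_, ?_, ?_, ?_, ?_, ?_⟩ <;> (try simp only [evalA, stepA]) <;> first | trivial | linarith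
    | r =>
      refine ⟨fun h => ?_, fun h => ?_⟩
      · -- odd → even: the ghosts are reset
        have hw : evenR w = false := by simpa [evenR] using h
        obtain ⟨h1, h2, h3, h4, h5, h6, h7, h8⟩ := ihO hw
        refine ⟨?_, ?_, ?_, ?_, ?_, ?_, ?_, ?_, ?_, ?_, ?_, ?_, ?_⟩ <;> (try simp only [evalA, ghost, stepA]) <;> first | trivial | linarith
      · -- even → odd
        have hw : evenR w = true := by simpa [evenR] using h
        obtain ⟨h1, h2, h3, h4, h5, h6, h7, h8, h9, h10, h11, h12, h13⟩ := ihE hw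
        refine ⟨?_, ?_, ?_, ?_, ?_, ?_, ?_, ?_⟩ <;> (try simp only [evalA, stepA]) <;> first | trivial | linarith

/-- The `a`-part is coefficientwise nonnegative: `0 ≤ A_a[w]` for every word. [this work] -/
theorem coeffA_nonneg (w : List Letter) : 0 ≤ coeffA w := by
  obtain ⟨hE, hO⟩ := inv_evalA w
  unfold coeffA alphaA
  cases h : evenR w with
  | true =>
    obtain ⟨h1, h2, h3, h4, h5, h6, h7, h8, h9, h10, h11, h12, h13⟩ := hE h
    linarith
  | false =>
    obtain ⟨h1, h2, h3, h4, h5, h6, h7, h8⟩ := hO h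
    rw [h3, h4, h5, h6, h7, h8]; norm_num

/-! ### 3. The `b`-part: product structure -/

/-- Invariant of the `b`-part: `E5 ≤ 0`, `−(f₁,f₂) ∈ K₁ = cone{e₁,(−1,1)}`, and `E4 ∈ {0,1}` records whether the word is in `p^*`. [this work] -/
theorem invB (w : List Letter) :
    (evalB w).E5 ≤ 0 ∧ 0 ≤ -(evalB w).f2 ∧ 0 ≤ -(evalB w).f1 - (evalB w).f2 ∧
      (allP w = true → (evalB w).E4 = 1) ∧ (allP w = false → (evalB w).E4 = 0) := by
  induction w with
  | nil =>
    refine ⟨?_, ?_, ?_, fun _ => ?_, fun h => ?_⟩ <;> simp [evalB, omegaB, allP] at *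
  | cons x w ih =>
    obtain ⟨h1, h2, h3, h4, h5⟩ := ih
    cases x with
    | p =>
      refine ⟨?_, ?_, ?_, fun h => ?_, fun h => ?_⟩ <;> simp only [evalB, stepB, allP] at * <;>
        first | linarith | exact h4 h | exact h5 h
    | q =>
      refine ⟨?_, ?_, ?_, fun h => ?_, fun h => ?_⟩ <;> simp only [evalB, stepB, allP] at * <;>
        first | linarith | cases h
    | r =>
      refine ⟨?_, ?_, ?_, fun h => ?_, fun h => ?_⟩ <;> simp only [evalB, stepB, allP] at * <;>
        first | linarith | cases h

/-- Off `p^*` the `b`-part is nonnegative: `A_b[w] = −30·E5 ≥ 0` when `w` contains a letter `q` or `r`. [this work] -/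
theorem coeffB_nonneg_of_not_allP (w : List Letter) (hw : allP w = false) : 0 ≤ coeffB w := by
  obtain ⟨h1, h2, h3, h4, h5⟩ := invB w
  unfold coeffB alphaB
  rw [h5 hw]
  linarith

/-- An all-`p` word is `p^k`. [this work] -/
theorem eq_replicate_of_allP (w : List Letter) (hw : allP w = true) : w = List.replicate w.length Letter.p := by
  induction w with
  | nil => rfl
  | cons x w ih =>
    cases x with
    | p =>
      have hw' : allP w = true := by simpa [allP] using hw
      simp only [List.length_cons, List.replicate_succ, List.cons.injEq, true_and]
      exact ih hw'
    | q => simp [allP] at hw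
    | r => simp [allP] at hw

/-- On `p^k` the `b`-part state is `(−(1/10)(5/4)^k, 1, 0, 0)`. [this work] -/
theorem evalB_replicate_p (k : ℕ) :
    evalB (List.replicate k Letter.p) = ⟨-(1/10) * (5/4) ^ k, 1, 0, 0⟩ := by
  induction k with
  | zero => simp only [List.replicate, evalB, omegaB]; norm_num
  | succ k ih =>
    rw [List.replicate_succ, evalB, ih]
    simp only [stepB, StB.mk.injEq]
    refine ⟨by ring, trivial, by ring, by ring⟩

/-- `A_b[p^k] = 3(5/4)^k − 12`. [this work] -/
theorem coeffB_replicate_p (k : ℕ) : coeffB (List.replicate k Letter.p) = 3 * (5/4) ^ k - 12 := by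
  unfold coeffB alphaB; rw [evalB_replicate_p]; ring

/-- `(5/4)^k ≥ 4` for `k ≥ 7`, hence `A_b[p^k] ≥ 0` there. [this work] -/
theorem coeffB_replicate_p_nonneg (k : ℕ) (hk : 7 ≤ k) : 0 ≤ coeffB (List.replicate k Letter.p) := by
  rw [coeffB_replicate_p]
  have h7 : (4 : ℚ) ≤ (5/4 : ℚ) ^ 7 := by norm_num
  have hmono : (5/4 : ℚ) ^ 7 ≤ (5/4 : ℚ) ^ k := pow_le_pow_right₀ (by norm_num) hk
  linarith

/-- The seven small values `4^k·A[p^k] = 0, 0, 0, 12, 180, 1704, 13032` (`= 2D_k`, THEOREM A's closed form). [this work] -/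
theorem coeff_replicate_p_small (k : ℕ) (hk : k ≤ 6) : 0 ≤ coeff (List.replicate k Letter.p) := by
  interval_cases k <;>
    simp only [List.replicate, coeff, coeffA, coeffB, evalA, evalB, stepA, stepB, omegaA, omegaB, alphaA, alphaB] <;>
    norm_num

/-! ### 4. THEOREM AB+ -/

/-- **THEOREM AB+ (all `k`).**  Every coefficient of the AM-form series is nonnegative: `0 ≤ A[w]` for every word `w` over
`{p, q, r}` of every length.  (Off `p^*` both parts are `≥ 0`; on `p^k`, `k ≥ 7`, both parts are `≥ 0`; `k ≤ 6` by evaluation.)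
[this work] -/
theorem coeff_nonneg (w : List Letter) : 0 ≤ coeff w := by
  cases hw : allP w with
  | false =>
    unfold coeff
    exact add_nonneg (coeffA_nonneg w) (coeffB_nonneg_of_not_allP w hw)
  | true =>
    rw [eq_replicate_of_allP w hw]
    by_cases hk : w.length ≤ 6
    · exact coeff_replicate_p_small _ hk
    · unfold coeff
      exact add_nonneg (coeffA_nonneg _) (coeffB_replicate_p_nonneg _ (by omega))

/-- Sanity values against gen 63's integer tables: `4·A[q] = 12`, `16·A[pq] = 72`, `16·A[qq] = 16`, `16·A[rr] = 96`,
`64·A[rqr] = 168`, `64·A[ppp] = 12`. [this work] -/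
theorem coeff_examples :
    4 * coeff [.q] = 12 ∧ 16 * coeff [.p, .q] = 72 ∧ 16 * coeff [.q, .q] = 16 ∧ 16 * coeff [.r, .r] = 96 ∧
      64 * coeff [.r, .q, .r] = 168 ∧ 64 * coeff [.p, .p, .p] = 12 := by
  simp only [coeff, coeffA, coeffB, evalA, evalB, stepA, stepB, omegaA, omegaB, alphaA, alphaB]
  norm_num

/-! ### 5. The hub cycle of every length in closed form (appended, gen 64):
`4^k · A[p^k] = 3·5^k − 12·4^k + (2k+9)·3^k = 2·D_k` — gen 62's THEOREM (`#P1 − #bad` of the hub cycle `H_k`) on the automaton -/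

/-- After the word `p^k` the `a`-part state satisfies: `t = (8/3)(3/4)^k`, the `U²`-coordinates are `4/5` of the `U¹`-coordinates
(the `p`-jump lies in the sub-module `W_{4/5}`), the odd coordinates vanish, and the `γ`-value
`−(45/14)ℓ₀ − 30e₁′ − (45/2)e₂′` equals `2k(3/4)^k` (γ is a left `3/4`-eigenvector of the `p`-step on `W_{4/5}` and `γ(j_p) = 9/16`:
THEOREM A's Perron cancellation). [this work] -/
theorem evalA_replicate_p (k : ℕ) :
    (evalA (List.replicate k Letter.p)).t = (8/3) * (3/4) ^ k ∧
    (evalA (List.replicate k Letter.p)).e1b = (4/5) * (evalA (List.replicate k Letter.p)).e1a ∧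
    (evalA (List.replicate k Letter.p)).e2b = (4/5) * (evalA (List.replicate k Letter.p)).e2a ∧
    (evalA (List.replicate k Letter.p)).o1 = 0 ∧ (evalA (List.replicate k Letter.p)).o2 = 0 ∧
    -(45/14) * (evalA (List.replicate k Letter.p)).l0 - 30 * (evalA (List.replicate k Letter.p)).e1a
      - (45/2) * (evalA (List.replicate k Letter.p)).e2a = 2 * (k : ℚ) * (3/4) ^ k := by
  induction k with
  | zero => simp only [List.replicate, evalA, omegaA]; norm_num
  | succ k ih =>
    obtain ⟨h1, h2, h3, h4, h5, h6⟩ := ih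
    rw [List.replicate_succ]
    simp only [evalA, stepA]
    refine ⟨?_, ?_, ?_, ?_, ?_, ?_⟩
    · rw [h1]; ring
    · rw [h3]; ring
    · rw [h2, h3]; ring
    · rw [h4]; ring
    · rw [h5]; ring
    · push_cast
      linear_combination (3/4 : ℚ) * h6 + (9/16 : ℚ) * h1

/-- `A_a[p^k] = (2k+9)(3/4)^k` for every `k`. [this work] -/
theorem coeffA_replicate_p (k : ℕ) : coeffA (List.replicate k Letter.p) = (2 * (k : ℚ) + 9) * (3/4) ^ k := by
  obtain ⟨h1, h2, h3, h4, h5, h6⟩ := evalA_replicate_p k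
  unfold coeffA alphaA
  rw [h2, h3]
  linear_combination (27/8 : ℚ) * h1 + h6

/-- `A[p^k] = (2k+9)(3/4)^k + 3(5/4)^k − 12` for every `k`. [this work] -/
theorem coeff_replicate_p (k : ℕ) :
    coeff (List.replicate k Letter.p) = (2 * (k : ℚ) + 9) * (3/4) ^ k + 3 * (5/4) ^ k - 12 := by
  unfold coeff; rw [coeffA_replicate_p, coeffB_replicate_p]; ring

/-- **The hub cycle of every length** (gen 62's closed form, all `k`): `4^k · A[p^k] = 3·5^k − 12·4^k + (2k+9)·3^k`,
i.e. `#P1(H_k) − #bad(H_k) = D_k = (3·5^k − 12·4^k + (2k+9)3^k)/2` for the cycle through the apex with one pendant hub per vertex,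
read on the normal-form automaton (`A[p^k] = 2D_k/4^k`). [this work] -/
theorem hubCycle_closed_form (k : ℕ) :
    4 ^ k * coeff (List.replicate k Letter.p) = 3 * 5 ^ k - 12 * 4 ^ k + (2 * (k : ℚ) + 9) * 3 ^ k := by
  rw [coeff_replicate_p]
  have h3 : (4 : ℚ) ^ k * (3/4) ^ k = 3 ^ k := by rw [← mul_pow]; norm_num
  have h5 : (4 : ℚ) ^ k * (5/4) ^ k = 5 ^ k := by rw [← mul_pow]; norm_num
  linear_combination (2 * (k : ℚ) + 9) * h3 + 3 * h5

end Summit.CriticalPhenomena.PercolationContinuityZ3.Theorems.ProductFormABPlus
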